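import Mathlib
import Summits.KontsevichZagierPeriods.Zeta5Search.WedgeDictionaryTopRelation
import Summits.KontsevichZagierPeriods.Zeta5Search.WedgeDictionaryDiagonalShift
import Summits.KontsevichZagierPeriods.Zeta5Search.Elimination.HalfShiftRaiseCore
import HarnessLib

/-!
# The closed forms of the record-ray connection over a general commutative ring (fam-tele g15, S4-R1 file 2a)

HONEST FRAMING: systematic search; no irrationality claim unless certified.  Pure algebra: this file evaluates
nothing about `ζ(5)`, linear forms or denominators.

The step matrices of the closed-form connection of the coefficient frame (`Certificates/RecordRayConnection`:
`raise7Mat`, `raiseMat`, `dsMat`, `hMat`, `hScale`) are built from the tree's closed forms `topGamma0..3`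
(`WedgeDictionaryTopRelation`), `kap`, `dsLam` (`WedgeDictionaryDiagonalShift`), `raiseTh1/2/3`, `raisePr`
(`Elimination/HalfShiftRaiseCore`, `HalfShiftMeet`), all of which are INTEGER POLYNOMIALS in the lattice point
`b`.  Here the same forms are transcribed VERBATIM with the point `b : ℕ → ℤ` (read in `ℚ`) replaced by a point
`x : ℕ → R` over an arbitrary commutative ring `R` (suffix `G`).  Three facts are recorded for each form `F`:

* `F_castPt : FG (castPt b) = F b` — at `R = ℚ`, `x = (b · : ℚ)` the transcription IS the tree's form (`rfl`);
* `map_F : f (FG x) = FG (f ∘ x)` for a ring hom `f : R →+* S` (naturality);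
* the affine record-ray points `rayPtG β ν = (41,17,16,15,14,13,12,11)·ν + β` and `castPt (rayPt β n) = rayPtG β n`.

These let ONE computation serve four rings: `ℚ` (the chain rule on the frame, file `RecordRayChain`), `ℤ → ZMod 97`
(the window-determinant certificate by `decide`, file `RecordRayWindow`), and `ℚ[X] → ℚ` (the Apéry-type
recursion, file `RecordRayApery`).  Blueprint: fam-tele g14 `KERNEL-BLUEPRINT-EN.md` §§2–5.
-/

namespace Summit.KontsevichZagierPeriods.Zeta5Search.RecordRay.Generic

open Summit.KontsevichZagierPeriods.Zeta5Search.WedgeDictionary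
open Summit.KontsevichZagierPeriods.Zeta5Search.Elimination

variable {R S : Type*} [CommRing R] [CommRing S]

/-! ### 1. Points -/

/-- An integer lattice point read in `ℚ`. -/
def castPt (b : ℕ → ℤ) : ℕ → ℚ := fun j => (b j : ℚ)

/-- `castPt` slot by slot. -/
@[simp] theorem castPt_apply (b : ℕ → ℤ) (j : ℕ) : castPt b j = (b j : ℚ) := rfl

/-- `x ↦ x + e_{i+1}` (the generic `bump`). -/
def bumpG (x : ℕ → R) (i : ℕ) : ℕ → R := Function.update x (i + 1) (x (i + 1) + 1)

/-- `bumpG` commutes with the cast of an integer point. -/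
theorem bumpG_castPt (b : ℕ → ℤ) (i : ℕ) : bumpG (castPt b) i = castPt (bump b i) := by
  funext j
  by_cases h : j = i + 1
  · subst h; simp [bumpG, bump, castPt]
  · simp [bumpG, bump, castPt, h]

/-- Naturality of `bumpG` along a ring hom (`map`). -/
theorem map_bumpG (f : R →+* S) (x : ℕ → R) (i : ℕ) : f ∘ bumpG x i = bumpG (f ∘ x) i := by
  funext j
  by_cases h : j = i + 1
  · subst h; simp [bumpG]
  · simp [bumpG, h]

/-- The direction `(41; 17,16,15,14,13,12,11)` of the record ray. -/
def rayDir : List ℤ := [41, 17, 16, 15, 14, 13, 12, 11]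

/-- The affine lattice point `n·(41;17,…,11) + β` (`β` = the list of its eight offsets). -/
def rayPt (β : List ℤ) (n : ℕ) : ℕ → ℤ := fun j => rayDir.getD j 0 * (n : ℤ) + β.getD j 0

/-- The same point over `R`, at the parameter `ν`. -/
def rayPtG (β : List ℤ) (ν : R) : ℕ → R := fun j => ((rayDir.getD j 0 : ℤ) : R) * ν + ((β.getD j 0 : ℤ) : R)

/-- The generic ray point at a cast parameter is the cast of the integer ray point. -/
theorem castPt_rayPt (β : List ℤ) (n : ℕ) : castPt (rayPt β n) = rayPtG β (n : ℚ) := by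
  funext j; simp [castPt, rayPt, rayPtG]

/-- Naturality of `rayPtG` along a ring hom (`map`). -/
theorem map_rayPtG (f : R →+* S) (β : List ℤ) (ν : R) : f ∘ rayPtG β ν = rayPtG β (f ν) := by
  funext j; simp [rayPtG]

/-! ### 2. The closed forms, transcribed (`WedgeDictionaryFaceRelation`, `…TopRelation`, `…DiagonalShift`,
`Elimination/HalfShiftMeet`, `Elimination/HalfShiftRaiseCore`, `RecordRayConnection.kap`) -/

section Forms

/-- Generic-ring copy of the tree's `fe1` (closed form, polynomial in the slots; see the module docstring). -/
def fe1G (x : ℕ → R) : R := x 1 + x 2 + x 3 + x 4 + x 5 + x 6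

/-- Generic-ring copy of the tree's `fe2` (closed form, polynomial in the slots; see the module docstring). -/
def fe2G (x : ℕ → R) : R :=
  x 1 * x 2 + x 1 * x 3 + x 1 * x 4 + x 1 * x 5 +
    x 1 * x 6 + x 2 * x 3 + x 2 * x 4 + x 2 * x 5 +
    x 2 * x 6 + x 3 * x 4 + x 3 * x 5 + x 3 * x 6 +
    x 4 * x 5 + x 4 * x 6 + x 5 * x 6

/-- Generic-ring copy of the tree's `fe3` (closed form, polynomial in the slots; see the module docstring). -/
def fe3G (x : ℕ → R) : R :=
  x 1 * x 2 * x 3 + x 1 * x 2 * x 4 + x 1 * x 2 * x 5 +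
    x 1 * x 2 * x 6 + x 1 * x 3 * x 4 + x 1 * x 3 * x 5 +
    x 1 * x 3 * x 6 + x 1 * x 4 * x 5 + x 1 * x 4 * x 6 +
    x 1 * x 5 * x 6 + x 2 * x 3 * x 4 + x 2 * x 3 * x 5 +
    x 2 * x 3 * x 6 + x 2 * x 4 * x 5 + x 2 * x 4 * x 6 +
    x 2 * x 5 * x 6 + x 3 * x 4 * x 5 + x 3 * x 4 * x 6 +
    x 3 * x 5 * x 6 + x 4 * x 5 * x 6

/-- Generic-ring copy of the tree's `fe4` (closed form, polynomial in the slots; see the module docstring). -/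
def fe4G (x : ℕ → R) : R :=
  x 1 * x 2 * x 3 * x 4 + x 1 * x 2 * x 3 * x 5 + x 1 * x 2 * x 3 * x 6 +
    x 1 * x 2 * x 4 * x 5 + x 1 * x 2 * x 4 * x 6 + x 1 * x 2 * x 5 * x 6 +
    x 1 * x 3 * x 4 * x 5 + x 1 * x 3 * x 4 * x 6 + x 1 * x 3 * x 5 * x 6 +
    x 1 * x 4 * x 5 * x 6 + x 2 * x 3 * x 4 * x 5 + x 2 * x 3 * x 4 * x 6 +
    x 2 * x 3 * x 5 * x 6 + x 2 * x 4 * x 5 * x 6 + x 3 * x 4 * x 5 * x 6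

/-- Generic-ring copy of the tree's `fe5` (closed form, polynomial in the slots; see the module docstring). -/
def fe5G (x : ℕ → R) : R :=
  x 1 * x 2 * x 3 * x 4 * x 5 + x 1 * x 2 * x 3 * x 4 * x 6 + x 1 * x 2 * x 3 * x 5 * x 6 +
    x 1 * x 2 * x 4 * x 5 * x 6 + x 1 * x 3 * x 4 * x 5 * x 6 + x 2 * x 3 * x 4 * x 5 * x 6

/-- Generic-ring copy of the tree's `fe6` (closed form, polynomial in the slots; see the module docstring). -/
def fe6G (x : ℕ → R) : R := x 1 * x 2 * x 3 * x 4 * x 5 * x 6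

/-- Generic-ring copy of the tree's `topA3` (closed form, polynomial in the slots; see the module docstring). -/
def topA3G (x : ℕ → R) : R := -3 * x 0 + x 7 + fe1G x + 1

/-- Generic-ring copy of the tree's `topA2` (closed form, polynomial in the slots; see the module docstring). -/
def topA2G (x : ℕ → R) : R :=
  -4 * x 0 ^ 3 + 3 * x 0 ^ 2 * x 7 + 3 * x 0 ^ 2 * fe1G x -
    2 * x 0 * x 7 * fe1G x + 6 * x 0 ^ 2 - 3 * x 0 * x 7 - 3 * x 0 * fe1G x -
    2 * x 0 * fe2G x + x 7 * fe1G x + x 7 * fe2G x + fe2G x + fe3G x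

/-- Generic-ring copy of the tree's `topA1` (closed form, polynomial in the slots; see the module docstring). -/
def topA1G (x : ℕ → R) : R :=
  -x 0 ^ 5 + x 0 ^ 4 * x 7 + x 0 ^ 4 * fe1G x - x 0 ^ 3 * x 7 * fe1G x +
    5 * x 0 ^ 4 - 4 * x 0 ^ 3 * x 7 - 4 * x 0 ^ 3 * fe1G x - x 0 ^ 3 * fe2G x +
    3 * x 0 ^ 2 * x 7 * fe1G x + x 0 ^ 2 * x 7 * fe2G x + 3 * x 0 ^ 2 * fe2G x +
    x 0 ^ 2 * fe3G x - 2 * x 0 * x 7 * fe2G x - x 0 * x 7 * fe3G x -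
    2 * x 0 * fe3G x - x 0 * fe4G x + x 7 * fe3G x + x 7 * fe4G x + fe4G x + fe5G x

/-- Generic-ring copy of the tree's `topA0` (closed form, polynomial in the slots; see the module docstring). -/
def topA0G (x : ℕ → R) : R :=
  x 0 ^ 6 - x 0 ^ 5 * x 7 - x 0 ^ 5 * fe1G x + x 0 ^ 4 * x 7 * fe1G x +
    x 0 ^ 4 * fe2G x - x 0 ^ 3 * x 7 * fe2G x - x 0 ^ 3 * fe3G x +
    x 0 ^ 2 * x 7 * fe3G x + x 0 ^ 2 * fe4G x - x 0 * x 7 * fe4G x -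
    x 0 * fe5G x + x 7 * fe5G x + x 7 * fe6G x + fe6G x

/-- Generic-ring copy of the tree's `yNode` (closed form, polynomial in the slots; see the module docstring). -/
def yNodeG (x : ℕ → R) (s : R) : R := -s * (x 0 - s)

/-- Generic-ring copy of the tree's `topGamma3` (closed form, polynomial in the slots; see the module docstring). -/
def topGamma3G (x : ℕ → R) : R := topA3G x

/-- Generic-ring copy of the tree's `topGamma2` (closed form, polynomial in the slots; see the module docstring). -/
def topGamma2G (x : ℕ → R) : R :=
  topA2G x + topA3G x * (yNodeG x (x 7) + yNodeG x (x 7 + 1) + yNodeG x (x 7 + 2))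

/-- Generic-ring copy of the tree's `topGamma1` (closed form, polynomial in the slots; see the module docstring). -/
def topGamma1G (x : ℕ → R) : R :=
  topA1G x + topA2G x * (yNodeG x (x 7) + yNodeG x (x 7 + 1)) +
    topA3G x * (yNodeG x (x 7) ^ 2 + yNodeG x (x 7) * yNodeG x (x 7 + 1) + yNodeG x (x 7 + 1) ^ 2)

/-- Generic-ring copy of the tree's `topGamma0` (closed form, polynomial in the slots; see the module docstring). -/
def topGamma0G (x : ℕ → R) : R :=
  topA0G x + topA1G x * yNodeG x (x 7) + topA2G x * yNodeG x (x 7) ^ 2 + topA3G x * yNodeG x (x 7) ^ 3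

/-- `κ_i` of `RecordRayConnection.kap`. -/
def kapG (x : ℕ → R) (i : ℕ) : R := x (i + 1) * (x 0 - x (i + 1)) - x 7 * (x 0 - x 7)

/-- Generic-ring copy of the tree's `dsLam` (closed form, polynomial in the slots; see the module docstring). -/
def dsLamG (x : ℕ → R) (i : ℕ) : R := (x (i + 1) + 1) * (x 0 - x (i + 1) + 1)

/-- Generic-ring copy of the tree's `meetD0` (closed form, polynomial in the slots; see the module docstring). -/
def meetD0G (x : ℕ → R) : R := x 0 - 1 - x 4 - x 5 - x 7

/-- Generic-ring copy of the tree's `meetA` (closed form, polynomial in the slots; see the module docstring). -/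
def meetAG (x : ℕ → R) : R :=
  meetD0G x * (x 7 + 1) * (x 0 + 1 - x 7) + (x 4 + 1) * (x 5 + 1) * (x 7 + 1)

/-- Generic-ring copy of the tree's `meetQ` (closed form, polynomial in the slots; see the module docstring). -/
def meetQG (x : ℕ → R) : R := -(2 * x 0 + 2 - x 1 - x 2 - x 3 - x 6)

/-- Generic-ring copy of the tree's `raiseM` (closed form, polynomial in the slots; see the module docstring). -/
def raiseMG (x : ℕ → R) : R := x 0 + 1

/-- Generic-ring copy of the tree's `uOf` (closed form, polynomial in the slots; see the module docstring). -/
def uOfG (x : ℕ → R) (j : ℕ) : R := x 0 + 1 - x j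

/-- Generic-ring copy of the tree's `raiseE1` (closed form, polynomial in the slots; see the module docstring). -/
def raiseE1G (x : ℕ → R) : R := uOfG x 1 + uOfG x 2 + uOfG x 3 + uOfG x 6

/-- Generic-ring copy of the tree's `raiseE2` (closed form, polynomial in the slots; see the module docstring). -/
def raiseE2G (x : ℕ → R) : R :=
  uOfG x 1 * uOfG x 2 + uOfG x 1 * uOfG x 3 + uOfG x 1 * uOfG x 6 + uOfG x 2 * uOfG x 3 + uOfG x 2 * uOfG x 6 +
    uOfG x 3 * uOfG x 6

/-- Generic-ring copy of the tree's `raiseE3` (closed form, polynomial in the slots; see the module docstring). -/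
def raiseE3G (x : ℕ → R) : R :=
  uOfG x 1 * uOfG x 2 * uOfG x 3 + uOfG x 1 * uOfG x 2 * uOfG x 6 + uOfG x 1 * uOfG x 3 * uOfG x 6 +
    uOfG x 2 * uOfG x 3 * uOfG x 6

/-- Generic-ring copy of the tree's `qForm` (closed form, polynomial in the slots; see the module docstring). -/
def qFormG (M e1 e2 e3 t : R) : R :=
  (e1 - 2 * M) * t ^ 2 + (e1 - M) * (e1 - 2 * M) * t + ((e1 - M) * e2 - e3 - M * (e1 - M) ^ 2)

/-- Generic-ring copy of the tree's `th2Form` (closed form, polynomial in the slots; see the module docstring). -/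
def th2FormG (M e1 e2 e3 w s1 s2 : R) : R :=
  (10 * e1 - 20 * M - 5 * e1 ^ 2 + 9 * M * e1 + 2 * M ^ 2 - 2 * e3 + 2 * e1 * e2 - 2 * M * e2 + M * e1 ^ 2 - 5 *
    M ^ 2 * e1 + 4 * M ^ 3 + M * e3 - M * e1 * e2 + M ^ 2 * e2 + M ^ 2 * e1 ^ 2 - 2 * M ^ 3 * e1 + M ^ 4 + s1 *
    (5 * e1 - 10 * M - 2 * e1 ^ 2 + 5 * M * e1 - 2 * M ^ 2 - e3 + e1 * e2 - M * e2 - M * e1 ^ 2 + 2 * M ^ 2 * e1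
    - M ^ 3) + s2 * (2 * e1 - 4 * M - e1 ^ 2 + 4 * M * e1 - 4 * M ^ 2) + w * (17 * e1 - 34 * M - 6 * e1 ^ 2 + 11
    * M * e1 + 2 * M ^ 2 - e3 + e1 * e2 - M * e2 + M * e1 ^ 2 - 4 * M ^ 2 * e1 + 3 * M ^ 3) + w * s1 * (6 * e1 -
    12 * M - e1 ^ 2 + 2 * M * e1) + w * s2 * (e1 - 2 * M) + w * w * (10 * e1 - 20 * M - 2 * e1 ^ 2 + 4 * M * e1)
    + w * w * s1 * (2 * e1 - 4 * M) + w ^ 3 * (2 * e1 - 4 * M))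

/-- Generic-ring copy of the tree's `raiseQ` (closed form, polynomial in the slots; see the module docstring). -/
def raiseQG (x : ℕ → R) (t : R) : R := qFormG (raiseMG x) (raiseE1G x) (raiseE2G x) (raiseE3G x) t

/-- Generic-ring copy of the tree's `raiseTh1` (closed form, polynomial in the slots; see the module docstring). -/
def raiseTh1G (x : ℕ → R) : R := meetAG x * raiseQG x (-(x 7 + 1))

/-- Generic-ring copy of the tree's `raiseTh2` (closed form, polynomial in the slots; see the module docstring). -/
def raiseTh2G (x : ℕ → R) : R :=
  th2FormG (raiseMG x) (raiseE1G x) (raiseE2G x) (raiseE3G x) (x 7) (x 4 + x 5) (x 4 * x 5)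

/-- Generic-ring copy of the tree's `raiseD` (closed form, polynomial in the slots; see the module docstring). -/
def raiseDG (x : ℕ → R) : R := 3 * x 0 - x 1 - x 2 - x 3 - x 4 - x 5 - x 6 - x 7

/-- Generic-ring copy of the tree's `raiseTh3` (closed form, polynomial in the slots; see the module docstring). -/
def raiseTh3G (x : ℕ → R) : R := raiseDG x * meetQG x

/-- Generic-ring copy of the tree's `raisePr` (closed form, polynomial in the slots; see the module docstring). -/
def raisePrG (x : ℕ → R) : R :=
  (x 0 + 1 - x 1 - x 2) * (x 0 + 1 - x 1 - x 3) * (x 0 + 1 - x 1 - x 6) *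
    (x 0 + 1 - x 2 - x 3) * (x 0 + 1 - x 2 - x 6) * (x 0 + 1 - x 3 - x 6)

end Forms

/-! ### 3. At `R = ℚ`, `x = castPt b` the transcriptions are the tree's forms -/

section CastPt
variable (b : ℕ → ℤ)

/-- `topGamma0G` at the cast of an integer point is the cast of its integer value. -/
theorem topGamma0G_castPt : topGamma0G (castPt b) = topGamma0 b := rfl
/-- `topGamma1G` at the cast of an integer point is the cast of its integer value. -/
theorem topGamma1G_castPt : topGamma1G (castPt b) = topGamma1 b := rfl
/-- `topGamma2G` at the cast of an integer point is the cast of its integer value. -/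
theorem topGamma2G_castPt : topGamma2G (castPt b) = topGamma2 b := rfl
/-- `topGamma3G` at the cast of an integer point is the cast of its integer value. -/
theorem topGamma3G_castPt : topGamma3G (castPt b) = topGamma3 b := rfl
/-- `dsLamG` at the cast of an integer point is the cast of its integer value. -/
theorem dsLamG_castPt (i : ℕ) : dsLamG (castPt b) i = dsLam b i := rfl
/-- `raiseTh1G` at the cast of an integer point is the cast of its integer value. -/
theorem raiseTh1G_castPt : raiseTh1G (castPt b) = raiseTh1 b := rfl
/-- `raiseTh2G` at the cast of an integer point is the cast of its integer value. -/
theorem raiseTh2G_castPt : raiseTh2G (castPt b) = raiseTh2 b := rfl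
/-- `raiseTh3G` at the cast of an integer point is the cast of its integer value. -/
theorem raiseTh3G_castPt : raiseTh3G (castPt b) = raiseTh3 b := rfl
/-- `raisePrG` at the cast of an integer point is the cast of its integer value. -/
theorem raisePrG_castPt : raisePrG (castPt b) = raisePr b := rfl

end CastPt

/-! ### 4. Naturality under ring homomorphisms -/

section Naturality
variable (f : R →+* S) (x : ℕ → R)

attribute [local simp] Function.comp_apply map_add map_sub map_mul map_neg map_pow map_one map_zero map_ofNat
  map_natCast map_intCast

/-- Naturality of `fe1G` along a ring hom (`map`). -/
theorem map_fe1G : f (fe1G x) = fe1G (f ∘ x) := by simp [fe1G]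
/-- Naturality of `fe2G` along a ring hom (`map`). -/
theorem map_fe2G : f (fe2G x) = fe2G (f ∘ x) := by simp [fe2G]
/-- Naturality of `fe3G` along a ring hom (`map`). -/
theorem map_fe3G : f (fe3G x) = fe3G (f ∘ x) := by simp [fe3G]
/-- Naturality of `fe4G` along a ring hom (`map`). -/
theorem map_fe4G : f (fe4G x) = fe4G (f ∘ x) := by simp [fe4G]
/-- Naturality of `fe5G` along a ring hom (`map`). -/
theorem map_fe5G : f (fe5G x) = fe5G (f ∘ x) := by simp [fe5G]
/-- Naturality of `fe6G` along a ring hom (`map`). -/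
theorem map_fe6G : f (fe6G x) = fe6G (f ∘ x) := by simp [fe6G]
/-- Naturality of `topA3G` along a ring hom (`map`). -/
theorem map_topA3G : f (topA3G x) = topA3G (f ∘ x) := by simp [topA3G, map_fe1G]
/-- Naturality of `topA2G` along a ring hom (`map`). -/
theorem map_topA2G : f (topA2G x) = topA2G (f ∘ x) := by simp [topA2G, map_fe1G, map_fe2G, map_fe3G]
/-- Naturality of `topA1G` along a ring hom (`map`). -/
theorem map_topA1G : f (topA1G x) = topA1G (f ∘ x) := by
  simp [topA1G, map_fe1G, map_fe2G, map_fe3G, map_fe4G, map_fe5G]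
/-- Naturality of `topA0G` along a ring hom (`map`). -/
theorem map_topA0G : f (topA0G x) = topA0G (f ∘ x) := by
  simp [topA0G, map_fe1G, map_fe2G, map_fe3G, map_fe4G, map_fe5G, map_fe6G]
/-- Naturality of `yNodeG` along a ring hom (`map`). -/
theorem map_yNodeG (s : R) : f (yNodeG x s) = yNodeG (f ∘ x) (f s) := by simp [yNodeG]
/-- Naturality of `topGamma3G` along a ring hom (`map`). -/
theorem map_topGamma3G : f (topGamma3G x) = topGamma3G (f ∘ x) := by simp [topGamma3G, map_topA3G]
/-- Naturality of `topGamma2G` along a ring hom (`map`). -/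
theorem map_topGamma2G : f (topGamma2G x) = topGamma2G (f ∘ x) := by
  simp [topGamma2G, map_topA2G, map_topA3G, map_yNodeG]
/-- Naturality of `topGamma1G` along a ring hom (`map`). -/
theorem map_topGamma1G : f (topGamma1G x) = topGamma1G (f ∘ x) := by
  simp [topGamma1G, map_topA1G, map_topA2G, map_topA3G, map_yNodeG]
/-- Naturality of `topGamma0G` along a ring hom (`map`). -/
theorem map_topGamma0G : f (topGamma0G x) = topGamma0G (f ∘ x) := by
  simp [topGamma0G, map_topA0G, map_topA1G, map_topA2G, map_topA3G, map_yNodeG]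
/-- Naturality of `kapG` along a ring hom (`map`). -/
theorem map_kapG (i : ℕ) : f (kapG x i) = kapG (f ∘ x) i := by simp [kapG]
/-- Naturality of `dsLamG` along a ring hom (`map`). -/
theorem map_dsLamG (i : ℕ) : f (dsLamG x i) = dsLamG (f ∘ x) i := by simp [dsLamG]
/-- Naturality of `meetD0G` along a ring hom (`map`). -/
theorem map_meetD0G : f (meetD0G x) = meetD0G (f ∘ x) := by simp [meetD0G]
/-- Naturality of `meetAG` along a ring hom (`map`). -/
theorem map_meetAG : f (meetAG x) = meetAG (f ∘ x) := by simp [meetAG, map_meetD0G]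
/-- Naturality of `meetQG` along a ring hom (`map`). -/
theorem map_meetQG : f (meetQG x) = meetQG (f ∘ x) := by simp [meetQG]
/-- Naturality of `raiseMG` along a ring hom (`map`). -/
theorem map_raiseMG : f (raiseMG x) = raiseMG (f ∘ x) := by simp [raiseMG]
/-- Naturality of `uOfG` along a ring hom (`map`). -/
theorem map_uOfG (j : ℕ) : f (uOfG x j) = uOfG (f ∘ x) j := by simp [uOfG]
/-- Naturality of `raiseE1G` along a ring hom (`map`). -/
theorem map_raiseE1G : f (raiseE1G x) = raiseE1G (f ∘ x) := by simp [raiseE1G, map_uOfG]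
/-- Naturality of `raiseE2G` along a ring hom (`map`). -/
theorem map_raiseE2G : f (raiseE2G x) = raiseE2G (f ∘ x) := by simp [raiseE2G, map_uOfG]
/-- Naturality of `raiseE3G` along a ring hom (`map`). -/
theorem map_raiseE3G : f (raiseE3G x) = raiseE3G (f ∘ x) := by simp [raiseE3G, map_uOfG]
/-- Naturality of `qFormG` along a ring hom (`map`). -/
theorem map_qFormG (M e1 e2 e3 t : R) :
    f (qFormG M e1 e2 e3 t) = qFormG (f M) (f e1) (f e2) (f e3) (f t) := by simp [qFormG]
/-- Naturality of `th2FormG` along a ring hom (`map`). -/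
theorem map_th2FormG (M e1 e2 e3 w s1 s2 : R) :
    f (th2FormG M e1 e2 e3 w s1 s2) = th2FormG (f M) (f e1) (f e2) (f e3) (f w) (f s1) (f s2) := by
  simp [th2FormG]
/-- Naturality of `raiseQG` along a ring hom (`map`). -/
theorem map_raiseQG (t : R) : f (raiseQG x t) = raiseQG (f ∘ x) (f t) := by
  simp [raiseQG, map_qFormG, map_raiseMG, map_raiseE1G, map_raiseE2G, map_raiseE3G]
/-- Naturality of `raiseTh1G` along a ring hom (`map`). -/
theorem map_raiseTh1G : f (raiseTh1G x) = raiseTh1G (f ∘ x) := by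
  simp [raiseTh1G, map_meetAG, map_raiseQG]
/-- Naturality of `raiseTh2G` along a ring hom (`map`). -/
theorem map_raiseTh2G : f (raiseTh2G x) = raiseTh2G (f ∘ x) := by
  simp [raiseTh2G, map_th2FormG, map_raiseMG, map_raiseE1G, map_raiseE2G, map_raiseE3G]
/-- Naturality of `raiseDG` along a ring hom (`map`). -/
theorem map_raiseDG : f (raiseDG x) = raiseDG (f ∘ x) := by simp [raiseDG]
/-- Naturality of `raiseTh3G` along a ring hom (`map`). -/
theorem map_raiseTh3G : f (raiseTh3G x) = raiseTh3G (f ∘ x) := by simp [raiseTh3G, map_raiseDG, map_meetQG]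
/-- Naturality of `raisePrG` along a ring hom (`map`). -/
theorem map_raisePrG : f (raisePrG x) = raisePrG (f ∘ x) := by simp [raisePrG]

end Naturality

end Summit.KontsevichZagierPeriods.Zeta5Search.RecordRay.Generic
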